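import Summits.NavierStokesRegularity.NavierStokesRegularity.Theses.HardyPointSink
import Summits.NavierStokesRegularity.NavierStokesRegularity.Theorems.HardyPointSinkHardyEnergyBoundLedgerCutoff
import Summits.NavierStokesRegularity.NavierStokesRegularity.Theorems.AdiabaticEddyClayUniquenessCore
import Literature.Analysis.FluidPDE.NSLerayHopfSereginEnergyProofs
import Literature.Analysis.FluidPDE.NSUnconditionalUniquenessHolds
import Literature.Analysis.FluidPDE.ClassicalTopPointRegularity
import Literature.Analysis.FluidPDE.RusinSverakLeraySolutions
import Literature.Analysis.FluidPDE.MildL3SmoothHolds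
import HarnessLib

/-!
# Route HardyPointSink — `HardyEnergyBound` (C2): necessity and localisation certificates

Helper file for the crux item stmt-NavierStokesRegularity-7979 (line `birth`, lead c2). The line is
closed modulo its heart `stub_influxAbsorption`, which the tree proves equivalent to the crux
(`hardyEnergyBound_iff_influxAbsorption`). This file pins down the logical position of the crux by
three tree theorems (none closes it):

* `hardyEnergyBound_necessity_hardy_le_of_norm_le` — a field bounded by `B` on a ball `B(c, ρ)` has
  local Hardy energy `∫_{B(c,ρ)} |w|²/|x − x₀| ≤ B² · (5/2)|B₁| ρ²` for EVERY sink `x₀` (the planner's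
  junk audit "C2 is vacuous where `u` is bounded", now a lemma);
* `hardyEnergyBound_of_navierStokesRegularity` — **NECESSITY**: the summit statement implies the crux.
  Given Clay (A), the Clay solution `(w, p)` from the datum of a Kato solution `u` on `[0, T)` agrees
  with `u` slice-wise a.e. (`exists_isTaoSolutionOn_of_isKatoSolutionOn` puts a Tao-class solution on
  every closed slab `[0, S]`, `S < T`, which is `u` a.e. by `kato_unique_holds` and is `w` by Tao's
  unconditional uniqueness `tao_unconditional_uniqueness_velocity_holds`), and `w` is continuous, hence
  bounded on `[0, T] × B̄(xs, 1)`. Contrapositive `not_navierStokesRegularity_of_not_hardyEnergyBound`: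
  refuting C2 means exhibiting finite-time blow-up from a Clay datum;
* `hardyEnergyBound_local_of_eLpNorm_parabolicCylinder_lt_top` — **LOCALISATION**: if the Kato solution
  is essentially bounded on ONE backward cylinder `Q_r(T, xs)` then the local Hardy bound of C2 holds at
  `xs`; so C2 has content exactly at the backward singular points `(T, xs)` of `u` (those with
  `‖u‖_{L^∞(Q_r(T,xs))} = ∞` for all `r > 0`, the conclusion shape of `BlowupHasSingularPoint`).
-/

noncomputable section

open MeasureTheory Set Filter Topology Metric Function
open scoped ENNReal NNReal

set_option linter.dupNamespace false -- nested layout Summit.<S>.<Sub>, Sub = S (D-0017)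

namespace Summit.NavierStokesRegularity.NavierStokesRegularity.Theorems

open Literature.Analysis.FluidPDE

/-! ### Bounded fields have bounded local Hardy energy -/

/-- **The Newtonian potential of a ball in `ℝ≥0∞` form**: `∫⁻_{B(c,ρ)} |x − x₀|ₑ⁻¹ ≤ (5/2)|B₁| ρ²`
for every sink `x₀` (the Bochner bound `hardyEnergyBound_ledger_setIntegral_inv_le`, transported
through `ofReal_integral_eq_lintegral_ofReal`; the integrand is `ofReal (|x − x₀|⁻¹)` off the null
set `{x₀}`). -/
theorem hardyEnergyBound_necessity_lintegral_inv_enorm_le (x₀ c : EuclideanSpace ℝ (Fin 3)) {ρ : ℝ}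
    (hρ : 0 < ρ) :
    ∫⁻ x in ball c ρ, (‖x - x₀‖ₑ)⁻¹ ≤
      ENNReal.ofReal (5 / 2 * (volume : Measure (EuclideanSpace ℝ (Fin 3))).real (ball 0 1) * ρ ^ 2) := by
  have hint := hardyEnergyBound_ledger_integrableOn_inv x₀ c ρ
  have hnn : 0 ≤ᵐ[volume.restrict (ball c ρ)] fun x : EuclideanSpace ℝ (Fin 3) => ‖x - x₀‖⁻¹ :=
    Eventually.of_forall fun x => inv_nonneg.2 (norm_nonneg _)
  have h1 : ∫⁻ x in ball c ρ, (‖x - x₀‖ₑ)⁻¹ = ∫⁻ x in ball c ρ, ENNReal.ofReal (‖x - x₀‖⁻¹) := by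
    refine lintegral_congr_ae ?_
    filter_upwards [ae_restrict_of_ae (s := ball c ρ) (hardyPointSink_ae_ne x₀)] with x hne
    have hr : 0 < ‖x - x₀‖ := norm_pos_iff.2 (sub_ne_zero.2 hne)
    rw [ENNReal.ofReal_inv_of_pos hr, ofReal_norm]
  rw [h1, ← ofReal_integral_eq_lintegral_ofReal hint hnn]
  exact ENNReal.ofReal_le_ofReal (hardyEnergyBound_ledger_setIntegral_inv_le x₀ c hρ)

/-- **A field bounded by `B` on the ball `B(c, ρ)` has local Hardy energy at most
`B² · (5/2)|B₁| ρ²` there, for every sink `x₀`.** Pointwise `|w|²/|x − x₀| ≤ B² |x − x₀|⁻¹` on the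
ball, then `hardyEnergyBound_necessity_lintegral_inv_enorm_le`. -/
theorem hardyEnergyBound_necessity_hardy_le_of_norm_le
    {w : EuclideanSpace ℝ (Fin 3) → EuclideanSpace ℝ (Fin 3)} {c : EuclideanSpace ℝ (Fin 3)} {ρ B : ℝ}
    (hρ : 0 < ρ) (hB : ∀ x ∈ ball c ρ, ‖w x‖ ≤ B) (x₀ : EuclideanSpace ℝ (Fin 3)) :
    ∫⁻ x in ball c ρ, ‖w x‖ₑ ^ 2 / ‖x - x₀‖ₑ ≤
      ENNReal.ofReal (B ^ 2 * (5 / 2 * (volume : Measure (EuclideanSpace ℝ (Fin 3))).real (ball 0 1) * ρ ^ 2)) := by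
  calc ∫⁻ x in ball c ρ, ‖w x‖ₑ ^ 2 / ‖x - x₀‖ₑ
      ≤ ∫⁻ x in ball c ρ, ENNReal.ofReal (B ^ 2) * (‖x - x₀‖ₑ)⁻¹ := by
        refine setLIntegral_mono' measurableSet_ball fun x hx => ?_
        rw [div_eq_mul_inv]
        gcongr
        rw [← ofReal_norm, ← ENNReal.ofReal_pow (norm_nonneg _)]
        exact ENNReal.ofReal_le_ofReal (pow_le_pow_left₀ (norm_nonneg _) (hB x hx) 2)
    _ = ENNReal.ofReal (B ^ 2) * ∫⁻ x in ball c ρ, (‖x - x₀‖ₑ)⁻¹ :=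
        lintegral_const_mul' _ _ ENNReal.ofReal_ne_top
    _ ≤ ENNReal.ofReal (B ^ 2) *
          ENNReal.ofReal (5 / 2 * (volume : Measure (EuclideanSpace ℝ (Fin 3))).real (ball 0 1) * ρ ^ 2) := by
        gcongr
        exact hardyEnergyBound_necessity_lintegral_inv_enorm_le x₀ c hρ
    _ = ENNReal.ofReal (B ^ 2 * (5 / 2 * (volume : Measure (EuclideanSpace ℝ (Fin 3))).real (ball 0 1) * ρ ^ 2)) :=
        (ENNReal.ofReal_mul (sq_nonneg B)).symm

/-! ### Necessity: the summit statement implies the crux -/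

/-- **Slice-wise identification of a Kato solution with the Clay solution.** For `ν > 0`, a Clay
datum `u₀`, a Kato solution `u` on `[0, T)` from `u₀` and a Clay-class solution `(w, p)` from `u₀`
(jointly smooth on `[0, ∞) × ℝ³`, Navier–Stokes, bounded energy): `u t = w t` a.e. for every
`t ∈ [0, T)`. At `t = 0` both are the datum. For `0 < t < T` put `S = (t + T)/2`: the tree's
`exists_isTaoSolutionOn_of_isKatoSolutionOn` gives a Tao-class solution `(v, q)` on `[0, S]` from
`u₀`; `v t = u t` a.e. (`IsTaoSolutionOn.ae_eq_of_kato`, i.e. `kato_unique_holds`); and `w = v` on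
`[0, S]` by Tao's unconditional uniqueness of finite-energy classical solutions from `H¹` data
(`tao_unconditional_uniqueness_velocity_holds`; the rapidly decaying datum is `H¹`,
`ClayUniqueness.memLp_two_of_rapidDecay`; the energy of `v` from the Leray–Hopf inequality). -/
theorem hardyEnergyBound_necessity_kato_ae_eq_clay {ν : ℝ} (hν : 0 < ν)
    {u₀ : EuclideanSpace ℝ (Fin 3) → EuclideanSpace ℝ (Fin 3)} (hsm : ContDiff ℝ (⊤ : ℕ∞) u₀)
    (hdiv : NSWave0.IsDivFree u₀) (hdec : HasRapidSpatialDecay u₀) {T : ℝ}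
    {u : ℝ → EuclideanSpace ℝ (Fin 3) → EuclideanSpace ℝ (Fin 3)} (hu : IsKatoSolutionOn T ν u₀ u)
    {w : ℝ → EuclideanSpace ℝ (Fin 3) → EuclideanSpace ℝ (Fin 3)} {p : ℝ → EuclideanSpace ℝ (Fin 3) → ℝ}
    (hws : IsSmoothOnHalfSpace w) (hps : IsSmoothOnHalfSpace p) (hns : IsNavierStokesSolution ν 0 u₀ w p)
    (hbe : HasBoundedEnergy w) : ∀ t ∈ Ico 0 T, u t =ᵐ[volume] w t := by
  intro t ht
  rcases ht.1.eq_or_lt with h0 | ht0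
  · subst h0
    rw [hu.initial, hns.initial]
  · -- a closed slab `[0, S]` with `t < S < T`
    set S : ℝ := (t + T) / 2 with hS
    have htS : t < S := by rw [hS]; linarith [ht.2]
    have hST : S < T := by rw [hS]; linarith [ht.2]
    have hS0 : 0 < S := ht0.trans htS
    -- the Tao-class solution from `u₀` on `[0, S]`
    obtain ⟨v, q, hv⟩ := exists_isTaoSolutionOn_of_isKatoSolutionOn hν hsm hdiv hdec hu hS0 hST
    -- it is the Kato solution a.e. at time `t`
    have huS : IsKatoSolutionOn S ν u₀ u := hu.mono hST.le
    have h1 : v t =ᵐ[volume] u t :=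
      hv.ae_eq_of_kato hν huS.mild huS.continuousInLpOn huS.aestronglyMeasurable t ⟨ht.1, htS⟩
    -- and it is the Clay solution at time `t` (Tao's unconditional uniqueness on `[0, S]`)
    have hclw : IsClassicalNSSolutionOn (Ici 0) ν 0 w p :=
      ⟨hws, hps, fun s hs x => hns.momentum s hs x, fun s hs => hns.divFree s hs⟩
    have hw' : IsClassicalNSSolutionOn (Icc 0 S) ν 0 w p :=
      hclw.mono (fun s hs => hs.1) (uniqueDiffOn_Icc hS0)
    have hC1 : ContDiff ℝ 1 u₀ := hsm.of_le (by norm_cast)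
    obtain ⟨hL2, hH1⟩ := ClayUniqueness.memLp_two_of_rapidDecay hdec hC1
    have hEw : ∃ C : ℝ≥0∞, C < ⊤ ∧ ∀ s ∈ Icc 0 S, ∫⁻ x, ‖w s x‖ₑ ^ 2 ≤ C := by
      obtain ⟨C, hC, hb⟩ := hbe
      exact ⟨C, hC, fun s hs => hb s hs.1⟩
    have hEv : ∃ C : ℝ≥0∞, C < ⊤ ∧ ∀ s ∈ Icc 0 S, ∫⁻ x, ‖v s x‖ₑ ^ 2 ≤ C :=
      ⟨ENNReal.ofReal (2 * VectorCalculus.kineticEnergy u₀), ENNReal.ofReal_lt_top,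
        fun s hs => hv.lintegral_enorm_sq_le hS0 hν.le hs⟩
    have h2 : w t = v t :=
      tao_unconditional_uniqueness_velocity_holds ν S hν hS0 u₀ hL2 hH1 w v p q hw' hv.classical
        hns.initial hv.initial hEw hEv t ⟨ht.1, htS.le⟩
    rw [h2]
    exact h1.symm

/-- **NECESSITY — the summit implies the crux: `NavierStokesRegularity → HardyEnergyBound`.**
Given Clay (A), a Kato solution `u` on `[0, T)` from a Clay datum agrees slice-wise a.e. with the
global smooth Clay solution `w` (`hardyEnergyBound_necessity_kato_ae_eq_clay`), which is jointly
continuous on `[0, ∞) × ℝ³`, hence bounded by some `B` on the compact set `[0, T] × B̄(xs, 1)`; so the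
local Hardy energy of `u t` on `B(xs, 1)` is at most `B² (5/2)|B₁|` for every sink and every
`t ∈ [0, T)` (`hardyEnergyBound_necessity_hardy_le_of_norm_le`), i.e. C2 holds with `r₀ = 1`.
Consequently C2 cannot be refuted without refuting the Millennium statement itself. -/
theorem hardyEnergyBound_of_navierStokesRegularity :
    _root_.NavierStokesRegularity →
      Summit.NavierStokesRegularity.NavierStokesRegularity.Theses.HardyPointSink.HardyEnergyBound := by
  intro hNS ν hν u₀ hsm hdiv hdec T u hT hu xs
  -- the Clay solution from `u₀`
  obtain ⟨w, p, hws, hps, hns, hbe⟩ := hNS ν hν u₀ hsm hdiv hdec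
  have hagree : ∀ t ∈ Ico 0 T, u t =ᵐ[volume] w t :=
    hardyEnergyBound_necessity_kato_ae_eq_clay hν hsm hdiv hdec hu hws hps hns hbe
  -- `w` is bounded on `[0, T] × B̄(xs, 1)`
  have hclw : IsClassicalNSSolutionOn (Ici 0) ν 0 w p :=
    ⟨hws, hps, fun s hs x => hns.momentum s hs x, fun s hs => hns.divFree s hs⟩
  have hcont : ContinuousOn (uncurry w) (Icc 0 T ×ˢ closedBall xs 1) :=
    hclw.smooth_velocity.continuousOn.mono (prod_mono Icc_subset_Ici_self (subset_univ _))
  obtain ⟨B, hB⟩ := (isCompact_Icc.prod (isCompact_closedBall xs 1)).exists_bound_of_continuousOn hcont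
  set X : ℝ := B ^ 2 * (5 / 2 * (volume : Measure (EuclideanSpace ℝ (Fin 3))).real (ball 0 1) * 1 ^ 2)
    with hX
  refine ⟨1, one_pos, X.toNNReal, fun x₀ _ t ht _ => ?_⟩
  have hKX : ((X.toNNReal : ℝ≥0) : ℝ≥0∞) = ENNReal.ofReal X := rfl
  -- the local Hardy energy of `u t` is that of `w t`
  have hHw : (∫⁻ x in ball xs 1, ‖u t x‖ₑ ^ 2 / ‖x - x₀‖ₑ)
      = ∫⁻ x in ball xs 1, ‖w t x‖ₑ ^ 2 / ‖x - x₀‖ₑ := by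
    refine lintegral_congr_ae ?_
    filter_upwards [ae_restrict_of_ae (s := ball xs 1) (hagree t ht)] with x hx
    rw [hx]
  rw [hHw, hKX, hX]
  refine hardyEnergyBound_necessity_hardy_le_of_norm_le one_pos (fun x hx => ?_) x₀
  exact hB (t, x) ⟨⟨ht.1, ht.2.le⟩, ball_subset_closedBall hx⟩

/-- **Contrapositive of necessity: refuting C2 refutes the summit.** A Kato solution from a Clay
datum whose local Hardy energy is unbounded near some point up to its lifespan is a finite-time
blow-up of the Clay problem (`hardyEnergyBound_of_navierStokesRegularity`). -/
theorem not_navierStokesRegularity_of_not_hardyEnergyBound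
    (h : ¬ Theses.HardyPointSink.HardyEnergyBound) : ¬ _root_.NavierStokesRegularity :=
  fun hNS => h (hardyEnergyBound_of_navierStokesRegularity hNS)

/-! ### Localisation: C2 has content only at backward singular points -/

/-- **LOCALISATION — essential boundedness on one backward cylinder gives the local Hardy bound.**
For `ν > 0`, a Clay datum `u₀`, `T > 0`, a Kato solution `u` on `[0, T)` and a centre `xs`: if
`‖u‖_{L^∞(Q_r(T, xs))} < ∞` for some `0 < r`, `r² < T`, then the conclusion of C2 holds at `xs`
(with `r₀ = r/2`). Proof: the classical representative `(v, q)` of `u` on `(0, T)`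
(`mild_L3_smooth_holds`) equals `u` a.e. on the strip `(0, T) × ℝ³` (`ae_restrict_prod_of_forall_ae_eq`),
hence on `Q_r(T, xs) ⊆ (0, T) × ℝ³` (`parabolicCylinder_subset_strip`), so `v` is essentially
bounded there and, being continuous on the open cylinder, bounded by
`M = ‖v‖_{L^∞(Q_r)}.toReal` pointwise (`exists_forall_norm_le_of_eLpNorm_top_lt_top`); for
`T − (r/2)² < t < T` and `x ∈ B(xs, r/2)` the point `(t, x)` lies in `Q_r(T, xs)`, and
`hardyEnergyBound_necessity_hardy_le_of_norm_le` bounds the Hardy energy of `v t = u t` (a.e.). So C2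
can only fail at `xs` if `(T, xs)` is a backward singular point of `u` (`‖u‖_{L^∞(Q_r(T,xs))} = ∞`
for every `r > 0`), the regime isolated by `BlowupHasSingularPoint`. -/
theorem hardyEnergyBound_local_of_eLpNorm_parabolicCylinder_lt_top {ν : ℝ} (hν : 0 < ν)
    {u₀ : EuclideanSpace ℝ (Fin 3) → EuclideanSpace ℝ (Fin 3)} {T : ℝ} (hT : 0 < T)
    {u : ℝ → EuclideanSpace ℝ (Fin 3) → EuclideanSpace ℝ (Fin 3)} (hu : IsKatoSolutionOn T ν u₀ u)
    {xs : EuclideanSpace ℝ (Fin 3)} {r : ℝ} (hr : 0 < r) (hrT : r ^ 2 < T)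
    (hfin : eLpNorm (uncurry u) ∞ (volume.restrict (parabolicCylinder r ((T : ℝ), xs))) < ⊤) :
    ∃ r₀ : ℝ, 0 < r₀ ∧ ∃ K : NNReal, ∀ x₀ ∈ Metric.ball xs r₀, ∀ t ∈ Set.Ico 0 T, T - r₀ ^ 2 < t →
      ∫⁻ x in Metric.ball xs r₀, ‖u t x‖ₑ ^ 2 / ‖x - x₀‖ₑ ≤ K := by
  -- the classical representative on the open strip
  obtain ⟨v, q, hcl, hae⟩ := mild_L3_smooth_holds hν hT (hu.memLp_initial hT)
    (hu.isWeaklyDivFree_initial hT) hu.mild hu.continuousInLpOn hu.aestronglyMeasurable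
  -- `v = u` a.e. on the strip, hence on the cylinder
  have hvmeas : AEStronglyMeasurable (uncurry v) (volume.restrict (Ioo 0 T ×ˢ univ)) :=
    (hcl.smooth_velocity.continuousOn).aestronglyMeasurable (measurableSet_Ioo.prod MeasurableSet.univ)
  have hstrip : uncurry v =ᵐ[volume.restrict (Ioo 0 T ×ˢ univ)] uncurry u :=
    ae_restrict_prod_of_forall_ae_eq hae hvmeas hu.aestronglyMeasurable
  have hsub : parabolicCylinder r ((T : ℝ), xs) ⊆ Ioo 0 T ×ˢ (univ : Set (EuclideanSpace ℝ (Fin 3))) :=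
    parabolicCylinder_subset_strip hrT.le le_rfl xs
  have hcyl : uncurry v =ᵐ[volume.restrict (parabolicCylinder r ((T : ℝ), xs))] uncurry u :=
    ae_restrict_of_ae_restrict_of_subset hsub hstrip
  have hfinv : eLpNorm (uncurry v) ∞ (volume.restrict (parabolicCylinder r ((T : ℝ), xs))) < ⊤ := by
    rwa [eLpNorm_congr_ae hcyl]
  -- `v` is continuous on the open cylinder, hence bounded there by `M`
  have hcontQ : ContinuousOn (uncurry v) (parabolicCylinder r ((T : ℝ), xs)) :=
    hcl.smooth_velocity.continuousOn.mono hsub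
  set M : ℝ := (eLpNorm (uncurry v) ∞ (volume.restrict (parabolicCylinder r ((T : ℝ), xs)))).toReal
    with hM
  have hbound : ∀ z ∈ parabolicCylinder r ((T : ℝ), xs), ‖uncurry v z‖ ≤ M :=
    exists_forall_norm_le_of_eLpNorm_top_lt_top (isOpen_parabolicCylinder r ((T : ℝ), xs)) hcontQ hfinv
  -- the scale `r₀ = r/2` and the constant
  set X : ℝ := M ^ 2 * (5 / 2 * (volume : Measure (EuclideanSpace ℝ (Fin 3))).real (ball 0 1) * (r / 2) ^ 2)
    with hX
  refine ⟨r / 2, by positivity, X.toNNReal, fun x₀ _ t ht hlt => ?_⟩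
  have hKX : ((X.toNNReal : ℝ≥0) : ℝ≥0∞) = ENNReal.ofReal X := rfl
  -- the time window: `T - r² < T - (r/2)² < t < T`, in particular `0 < t`
  have ht0 : 0 < t := by nlinarith [ht.2, hlt, hrT]
  have htr : T - r ^ 2 < t := by nlinarith [hlt, sq_nonneg r]
  have htI : t ∈ Ioo 0 T := ⟨ht0, ht.2⟩
  -- the local Hardy energy of `u t` is that of `v t`
  have hHv : (∫⁻ x in ball xs (r / 2), ‖u t x‖ₑ ^ 2 / ‖x - x₀‖ₑ)
      = ∫⁻ x in ball xs (r / 2), ‖v t x‖ₑ ^ 2 / ‖x - x₀‖ₑ := by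
    refine lintegral_congr_ae ?_
    filter_upwards [ae_restrict_of_ae (s := ball xs (r / 2)) (hae t htI)] with x hx
    rw [hx]
  rw [hHv, hKX, hX]
  refine hardyEnergyBound_necessity_hardy_le_of_norm_le (by positivity) (fun x hx => ?_) x₀
  have hz : ((t, x) : ℝ × EuclideanSpace ℝ (Fin 3)) ∈ parabolicCylinder r ((T : ℝ), xs) := by
    rw [mem_parabolicCylinder]
    refine ⟨⟨htr, ht.2⟩, ?_⟩
    have hx' : dist x xs < r / 2 := mem_ball.1 hx
    simpa using (hx'.trans (by linarith))
  exact hbound (t, x) hz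

end Summit.NavierStokesRegularity.NavierStokesRegularity.Theorems

end
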